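import Mathlib
import Summits.NavierStokesRegularity.NavierStokesRegularity.Theorems.L3TimeExponentPincerScaledEnergyCausalCylinder
import Summits.NavierStokesRegularity.NavierStokesRegularity.Theorems.L3TimeExponentPincerJawFullMorrey
import HarnessLib.Audit
import HarnessLib

/-!
# The full-Morrey-Type-I class is Type I in `A`, `C`, `E` on ALL late parabolic cylinders
# (route `L3TimeExponentPincer`, crux `L3CascadeJaw`, stmt-NavierStokesRegularity-19499)

Support file for the parent crux `L3CascadeJaw` (cell ns-regularity-ideate, seat nsreg-p4 gen 6).  THEOREM J′
(`…JawFullMorreyHolds`) decides the crux on the class `FullMorreyTypeINear` (scaled energies `r⁻¹∫_{B(x,r)}|u(t)|² ≤ M`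
for all late `t`, all centres, all `r < r₁`), so the open remainder of the crux and the residual's Type-I content
are measured against that class.  This file places the class inside Seregin's ENERGY-Type-I class for the two
other velocity quantities, using the causal-cylinder bounds of `…ScaledEnergyCausalCylinder` (Jia–Šverák 2014
Lemma 3.1 transported to the frame):

* `cylinder_bounds_steps` — the covering step: with `h = ε₁ r² min(ν⁻¹, ν³/M²)` the causal window at scale `r` on
  the class, for every `n`, the cylinder `(a, min(t, a + n h)) × B(x,r)` (base `a = t - r²` inside the Morrey window)
  has `∫∫ |∇u|² ≤ n K_E M r/ν` and `∫∫ |u|³ ≤ n K_C M^{3/2} r²/ν` — re-basing on the every-time Morrey bound at each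
  step (no compounding of constants);
* `exists_parabolicCylinder_bounds_of_fullMorrey` / `…_of_fullMorreyTypeINear` — **on the full-Morrey-Type-I class
  there is `K = K(ν, M)` with `∫∫_{Q_r(t,x)} |∇u|² ≤ K r` and `∫∫_{Q_r(t,x)} |u|³ ≤ K r²` for EVERY late parabolic
  cylinder `Q_r(t,x) = (t - r², t) × B(x,r)`, `t ≤ T`, `r < r₁`** (`⌈1/(ε₁ min(ν⁻¹, ν³/M²))⌉ + 1` causal windows cover
  `(t - r², t)`): scaled `E ≤ K` and `C ≤ K` uniformly — the class of J′ is Type I in `A, C, E` in the sense of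
  Seregin / Albritton–Barker (the pressure quantity `D` is not treated here).

References: G. Seregin, *Lecture notes on regularity theory for the Navier–Stokes equations* (2014), Ch. 6;
D. Albritton, T. Barker, J. Math. Fluid Mech. 21 (2019), §1–2 (`A, C, E`, Lemma 2.6); H. Jia, V. Šverák,
Invent. Math. 196 (2014), Lemma 3.1.
WHAT THIS IS NOT: not a claim about Navier–Stokes regularity or blow-up; an energy-class a priori estimate on a
typed sub-class, landed `--supports` as a helper; no item is closed.
-/

noncomputable section

namespace Summit.NavierStokesRegularity.NavierStokesRegularity.Theorems.L3TimeExponentPincerFullMorreyTypeICylinders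

open MeasureTheory Set Function Filter Metric Topology TopologicalSpace
open scoped ENNReal NNReal
open Literature.Analysis.FluidPDE
open Summit.NavierStokesRegularity.NavierStokesRegularity.Theorems.L3TimeExponentPincerScaledEnergyCausalCylinder
  (exists_causalCylinder_bounds)
open Summit.NavierStokesRegularity.NavierStokesRegularity.Theorems.L3TimeExponentPincerJawFullMorrey (FullMorreyTypeINear)

/-! ## §1  Splitting a space–time cylinder at a time -/

/-- A time slice of a cylinder is Lebesgue-null in `ℝ × ℝ³`. -/
theorem volume_singleton_prod (b : ℝ) (B : Set (EuclideanSpace ℝ (Fin 3))) :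
    volume (({b} : Set ℝ) ×ˢ B) = 0 := by
  rw [Measure.volume_eq_prod, Measure.prod_prod, Real.volume_singleton, zero_mul]

/-- Splitting the time interval of a cylinder: `∫∫_{(a,c)×B} f ≤ ∫∫_{(a,b)×B} f + ∫∫_{(b,c)×B} f` (the slice
`{b} × B` is null). -/
theorem lintegral_cylinder_split (f : ℝ × EuclideanSpace ℝ (Fin 3) → ℝ≥0∞) (a b c : ℝ)
    (B : Set (EuclideanSpace ℝ (Fin 3))) :
    ∫⁻ z in Ioo a c ×ˢ B, f z ≤ (∫⁻ z in Ioo a b ×ˢ B, f z) + ∫⁻ z in Ioo b c ×ˢ B, f z := by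
  have hsub : Ioo a c ×ˢ B ⊆ (Ioo a b ×ˢ B ∪ Ioo b c ×ˢ B) ∪ ({b} : Set ℝ) ×ˢ B := by
    rintro ⟨s, y⟩ ⟨hs, hy⟩
    rcases lt_trichotomy s b with h | h | h
    · exact Or.inl (Or.inl ⟨⟨hs.1, h⟩, hy⟩)
    · exact Or.inr ⟨h, hy⟩
    · exact Or.inl (Or.inr ⟨⟨h, hs.2⟩, hy⟩)
  calc ∫⁻ z in Ioo a c ×ˢ B, f z ≤ ∫⁻ z in (Ioo a b ×ˢ B ∪ Ioo b c ×ˢ B) ∪ ({b} : Set ℝ) ×ˢ B, f z :=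
        lintegral_mono_set hsub
    _ ≤ (∫⁻ z in Ioo a b ×ˢ B ∪ Ioo b c ×ˢ B, f z) + ∫⁻ z in ({b} : Set ℝ) ×ˢ B, f z := lintegral_union_le _ _ _
    _ = ∫⁻ z in Ioo a b ×ˢ B ∪ Ioo b c ×ˢ B, f z := by
        rw [setLIntegral_measure_zero _ _ (volume_singleton_prod b B), add_zero]
    _ ≤ _ := lintegral_union_le _ _ _

/-! ## §2  Covering a parabolic cylinder by causal windows -/

/-- **Covering step.**  Frame solution with the Morrey bound `∫_{B(y,ρ)} |u(s)|² ≤ M ρ` for `s ∈ (T₁,T)`, all `y`,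
`ρ < r₁`; fix `x`, `0 < r < r₁`, a base time `a` with `max(T₁,0) < a` and a top time `t ≤ T`.
With `h = ε₁ r² min(ν⁻¹, ν³/M²)`, for every `n : ℕ` the cylinder `(a, min(t, a + n h)) × B(x,r)` satisfies
`∫∫ |∇u|² ≤ n K_E M r/ν` and `∫∫ |u|³ ≤ n K_C M^{3/2} r²/ν` (`ε₁, K_E, K_C` the constants of
`exists_causalCylinder_bounds`). -/
theorem cylinder_bounds_steps {ε₁ K_E K_C : ℝ}
    (hcc : ∀ (ν T : ℝ), 0 < ν → 0 < T →
      ∀ (u : ℝ → EuclideanSpace ℝ (Fin 3) → EuclideanSpace ℝ (Fin 3)) (p : ℝ → EuclideanSpace ℝ (Fin 3) → ℝ),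
        IsClassicalNSSolutionOn (Ico 0 T) ν 0 u p → IsLerayHopfOn T ν 0 (u 0) u → HasRapidSpatialDecay (u 0) →
        ∀ t₀ ∈ Ioo 0 T, ∀ r : ℝ, 0 < r → ∀ A : ℝ, 0 < A →
          (∀ x : EuclideanSpace ℝ (Fin 3), ∫⁻ y in ball x r, ‖u t₀ y‖ₑ ^ 2 ≤ ENNReal.ofReal (A * r)) →
          ∀ x : EuclideanSpace ℝ (Fin 3),
            (∫⁻ z in Ioo t₀ (t₀ + min (ε₁ * r ^ 2 * min ν⁻¹ (ν ^ 3 / A ^ 2)) (T - t₀)) ×ˢ ball x r,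
                ENNReal.ofReal (frobeniusNormSq (fderiv ℝ (u z.1) z.2))) ≤ ENNReal.ofReal (K_E * A * r / ν) ∧
            (∫⁻ z in Ioo t₀ (t₀ + min (ε₁ * r ^ 2 * min ν⁻¹ (ν ^ 3 / A ^ 2)) (T - t₀)) ×ˢ ball x r,
                ‖u z.1 z.2‖ₑ ^ (3 : ℕ)) ≤ ENNReal.ofReal (K_C * A ^ (3 / 2 : ℝ) * r ^ 2 / ν))
    (hε₁ : 0 < ε₁) (hKE : 0 ≤ K_E) (hKC : 0 ≤ K_C)
    {ν T : ℝ} (hν : 0 < ν) (hT : 0 < T)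
    {u : ℝ → EuclideanSpace ℝ (Fin 3) → EuclideanSpace ℝ (Fin 3)} {p : ℝ → EuclideanSpace ℝ (Fin 3) → ℝ}
    (hcl : IsClassicalNSSolutionOn (Ico 0 T) ν 0 u p) (hLH : IsLerayHopfOn T ν 0 (u 0) u)
    (hdec : HasRapidSpatialDecay (u 0)) {M r₁ T₁ : ℝ} (hM : 0 < M)
    (hMor : ∀ s ∈ Ioo T₁ T, ∀ y : EuclideanSpace ℝ (Fin 3), ∀ ρ : ℝ, 0 < ρ → ρ < r₁ →
      ∫⁻ w in ball y ρ, ‖u s w‖ₑ ^ 2 ≤ ENNReal.ofReal (M * ρ))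
    (x : EuclideanSpace ℝ (Fin 3)) {r : ℝ} (hr : 0 < r) (hrr₁ : r < r₁) {a t : ℝ} (ha : max T₁ 0 < a)
    (htT : t ≤ T) (n : ℕ) :
    (∫⁻ z in Ioo a (min t (a + n * (ε₁ * r ^ 2 * min ν⁻¹ (ν ^ 3 / M ^ 2)))) ×ˢ ball x r,
        ENNReal.ofReal (frobeniusNormSq (fderiv ℝ (u z.1) z.2))) ≤ ENNReal.ofReal (n * (K_E * M * r / ν)) ∧
    (∫⁻ z in Ioo a (min t (a + n * (ε₁ * r ^ 2 * min ν⁻¹ (ν ^ 3 / M ^ 2)))) ×ˢ ball x r,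
        ‖u z.1 z.2‖ₑ ^ (3 : ℕ)) ≤ ENNReal.ofReal (n * (K_C * M ^ (3 / 2 : ℝ) * r ^ 2 / ν)) := by
  set h : ℝ := ε₁ * r ^ 2 * min ν⁻¹ (ν ^ 3 / M ^ 2) with hh
  have hh0 : 0 ≤ h := by
    rw [hh]
    exact mul_nonneg (mul_nonneg hε₁.le (sq_nonneg r)) (le_min (inv_nonneg.2 hν.le) (by positivity))
  have hBE : 0 ≤ K_E * M * r / ν := by positivity
  have hBC : 0 ≤ K_C * M ^ (3 / 2 : ℝ) * r ^ 2 / ν := by positivity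
  induction n with
  | zero =>
    simp only [Nat.cast_zero, zero_mul, add_zero]
    have hempty : Ioo a (min t a) = ∅ := Ioo_eq_empty (not_lt.2 (min_le_right _ _))
    rw [hempty, empty_prod, Measure.restrict_empty, lintegral_zero_measure, lintegral_zero_measure]
    exact ⟨bot_le, bot_le⟩
  | succ n ih =>
    obtain ⟨ihE, ihC⟩ := ih
    set s : ℝ := a + n * h with hs
    have hs_succ : a + ((n + 1 : ℕ) : ℝ) * h = s + h := by rw [hs]; push_cast; ring
    rw [hs_succ]
    by_cases hst : t ≤ s
    · -- nothing new: both truncations equal `t`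
      have e1 : min t (s + h) = t := min_eq_left (hst.trans (by linarith))
      have e2 : min t s = t := min_eq_left hst
      rw [e1]
      rw [e2] at ihE ihC
      have hmono : (n : ℝ) ≤ ((n + 1 : ℕ) : ℝ) := by push_cast; linarith
      exact ⟨ihE.trans (ENNReal.ofReal_le_ofReal (mul_le_mul_of_nonneg_right hmono hBE)),
        ihC.trans (ENNReal.ofReal_le_ofReal (mul_le_mul_of_nonneg_right hmono hBC))⟩
    · -- a new causal window based at `s ∈ (a, t) ⊆ (max T₁ 0, T)`
      rw [not_le] at hst
      have has : a ≤ s := by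
        rw [hs]
        have : 0 ≤ (n : ℝ) * h := mul_nonneg n.cast_nonneg hh0
        linarith
      have hs0 : 0 < s := lt_of_lt_of_le (lt_of_le_of_lt (le_max_right _ _) ha) has
      have hsT : s < T := lt_of_lt_of_le hst htT
      have hsT₁ : T₁ < s := lt_of_lt_of_le (lt_of_le_of_lt (le_max_left _ _) ha) has
      have hdat : ∀ y : EuclideanSpace ℝ (Fin 3), ∫⁻ w in ball y r, ‖u s w‖ₑ ^ 2 ≤ ENNReal.ofReal (M * r) :=
        fun y => hMor s ⟨hsT₁, hsT⟩ y r hr hrr₁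
      obtain ⟨hE, hC⟩ := hcc ν T hν hT u p hcl hLH hdec s ⟨hs0, hsT⟩ r hr M hM hdat x
      -- the new piece `(s, min t (s+h))` lies in the causal window `(s, s + min h (T - s))`
      have hpiece : Ioo s (min t (s + h)) ×ˢ ball x r ⊆ Ioo s (s + min h (T - s)) ×ˢ ball x r := by
        refine prod_mono (Ioo_subset_Ioo_right ?_) Subset.rfl
        rw [← min_add_add_left, add_sub_cancel]
        exact le_min (min_le_right _ _) ((min_le_left _ _).trans htT)
      have hE' := (lintegral_mono_set hpiece).trans hE
      have hC' := (lintegral_mono_set hpiece).trans hC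
      have hcast : (((n + 1 : ℕ) : ℝ)) = n + 1 := by push_cast; ring
      refine ⟨(lintegral_cylinder_split _ a (min t s) _ _).trans ?_, (lintegral_cylinder_split _ a (min t s) _ _).trans ?_⟩
      · rw [min_eq_right hst.le] at ihE ⊢
        calc (∫⁻ z in Ioo a s ×ˢ ball x r, ENNReal.ofReal (frobeniusNormSq (fderiv ℝ (u z.1) z.2))) +
              ∫⁻ z in Ioo s (min t (s + h)) ×ˢ ball x r, ENNReal.ofReal (frobeniusNormSq (fderiv ℝ (u z.1) z.2))
            ≤ ENNReal.ofReal (n * (K_E * M * r / ν)) + ENNReal.ofReal (K_E * M * r / ν) := add_le_add ihE hE'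
          _ = ENNReal.ofReal (((n + 1 : ℕ) : ℝ) * (K_E * M * r / ν)) := by
              rw [← ENNReal.ofReal_add (by positivity) hBE, hcast]; ring_nf
      · rw [min_eq_right hst.le] at ihC ⊢
        calc (∫⁻ z in Ioo a s ×ˢ ball x r, ‖u z.1 z.2‖ₑ ^ (3 : ℕ)) +
              ∫⁻ z in Ioo s (min t (s + h)) ×ˢ ball x r, ‖u z.1 z.2‖ₑ ^ (3 : ℕ)
            ≤ ENNReal.ofReal (n * (K_C * M ^ (3 / 2 : ℝ) * r ^ 2 / ν)) +
                ENNReal.ofReal (K_C * M ^ (3 / 2 : ℝ) * r ^ 2 / ν) := add_le_add ihC hC'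
          _ = ENNReal.ofReal (((n + 1 : ℕ) : ℝ) * (K_C * M ^ (3 / 2 : ℝ) * r ^ 2 / ν)) := by
              rw [← ENNReal.ofReal_add (by positivity) hBC, hcast]; ring_nf

/-- **The full-Morrey-Type-I class is Type I in `E` and `C` on every late parabolic cylinder.**  Frame solution
with `∫_{B(y,ρ)} |u(s)|² ≤ M ρ` for all `s ∈ (T₁,T)`, all `y`, all `ρ < r₁`: there is `K ≥ 0` (depending on
`ν, M` and absolute constants only) such that every parabolic cylinder `Q_r(t,x) = (t - r², t) × B(x,r)` with
`t ≤ T`, `0 < r < r₁` and `max(T₁,0) < t - r²` has `∫∫_{Q_r(t,x)} |∇u|²_F ≤ K r` and `∫∫_{Q_r(t,x)} |u|³ ≤ K r²`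
(i.e. the scaled quantities `E`, `C` of Caffarelli–Kohn–Nirenberg / Albritton–Barker are `≤ K`). [cite: Seregin2014, Ch. 6]
[cite: JiaSverak2014, Lemma 3.1] -/
theorem exists_parabolicCylinder_bounds_of_fullMorrey {ν T : ℝ} (hν : 0 < ν) (hT : 0 < T)
    {u : ℝ → EuclideanSpace ℝ (Fin 3) → EuclideanSpace ℝ (Fin 3)} {p : ℝ → EuclideanSpace ℝ (Fin 3) → ℝ}
    (hcl : IsClassicalNSSolutionOn (Ico 0 T) ν 0 u p) (hLH : IsLerayHopfOn T ν 0 (u 0) u)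
    (hdec : HasRapidSpatialDecay (u 0)) {M r₁ T₁ : ℝ} (hM : 0 < M)
    (hMor : ∀ s ∈ Ioo T₁ T, ∀ y : EuclideanSpace ℝ (Fin 3), ∀ ρ : ℝ, 0 < ρ → ρ < r₁ →
      ∫⁻ w in ball y ρ, ‖u s w‖ₑ ^ 2 ≤ ENNReal.ofReal (M * ρ)) :
    ∃ K : ℝ, 0 ≤ K ∧ ∀ t : ℝ, t ≤ T → ∀ r : ℝ, 0 < r → r < r₁ → max T₁ 0 < t - r ^ 2 →
      ∀ x : EuclideanSpace ℝ (Fin 3),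
        (∫⁻ z in Ioo (t - r ^ 2) t ×ˢ ball x r, ENNReal.ofReal (frobeniusNormSq (fderiv ℝ (u z.1) z.2))) ≤
            ENNReal.ofReal (K * r) ∧
        (∫⁻ z in Ioo (t - r ^ 2) t ×ˢ ball x r, ‖u z.1 z.2‖ₑ ^ (3 : ℕ)) ≤ ENNReal.ofReal (K * r ^ 2) := by
  obtain ⟨ε₁, hε₁, K_E, hKE, K_C, hKC, hcc⟩ := exists_causalCylinder_bounds
  set κ : ℝ := ε₁ * min ν⁻¹ (ν ^ 3 / M ^ 2) with hκ
  have hκpos : 0 < κ := by rw [hκ]; exact mul_pos hε₁ (lt_min (inv_pos.2 hν) (by positivity))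
  set N : ℕ := ⌈κ⁻¹⌉₊ with hN
  have hNκ : 1 ≤ (N : ℝ) * κ := by
    have h1 : κ⁻¹ ≤ (N : ℝ) := Nat.le_ceil _
    calc (1 : ℝ) = κ⁻¹ * κ := (inv_mul_cancel₀ hκpos.ne').symm
      _ ≤ (N : ℝ) * κ := mul_le_mul_of_nonneg_right h1 hκpos.le
  refine ⟨(N : ℝ) * max (K_E * M / ν) (K_C * M ^ (3 / 2 : ℝ) / ν), by positivity, ?_⟩
  intro t htT r hr hrr₁ hbase x
  have key := cylinder_bounds_steps hcc hε₁ hKE hKC hν hT hcl hLH hdec hM hMor x hr hrr₁ hbase htT N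
  -- `N` windows of length `κ r²` cover `(t - r², t)`
  have hcov : min t (t - r ^ 2 + (N : ℝ) * (ε₁ * r ^ 2 * min ν⁻¹ (ν ^ 3 / M ^ 2))) = t := by
    refine min_eq_left ?_
    have : r ^ 2 ≤ (N : ℝ) * (ε₁ * r ^ 2 * min ν⁻¹ (ν ^ 3 / M ^ 2)) := by
      have e : (N : ℝ) * (ε₁ * r ^ 2 * min ν⁻¹ (ν ^ 3 / M ^ 2)) = ((N : ℝ) * κ) * r ^ 2 := by rw [hκ]; ring
      rw [e]
      nlinarith [sq_nonneg r, hNκ]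
    linarith
  rw [hcov] at key
  obtain ⟨hE, hC⟩ := key
  refine ⟨hE.trans (ENNReal.ofReal_le_ofReal ?_), hC.trans (ENNReal.ofReal_le_ofReal ?_)⟩
  · have : (N : ℝ) * (K_E * M * r / ν) = ((N : ℝ) * (K_E * M / ν)) * r := by ring
    rw [this]
    exact mul_le_mul_of_nonneg_right (mul_le_mul_of_nonneg_left (le_max_left _ _) N.cast_nonneg) hr.le
  · have : (N : ℝ) * (K_C * M ^ (3 / 2 : ℝ) * r ^ 2 / ν) = ((N : ℝ) * (K_C * M ^ (3 / 2 : ℝ) / ν)) * r ^ 2 := by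
      ring
    rw [this]
    exact mul_le_mul_of_nonneg_right (mul_le_mul_of_nonneg_left (le_max_right _ _) N.cast_nonneg) (by positivity)

/-- **Packaged on `FullMorreyTypeINear`** (THEOREM J′'s class): for a frame solution in the full-Morrey-Type-I
class there are `K ≥ 0`, `r₁ > 0` and `T₁' < T` such that every parabolic cylinder `(t - r², t) × B(x,r)` with
`t ≤ T`, `0 < r < r₁`, `T₁' < t - r²` has scaled dissipation and scaled cubic functional `≤ K`:
`∫∫ |∇u|²_F ≤ K r`, `∫∫ |u|³ ≤ K r²` — the class is Type I in `A, C, E`. -/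
theorem exists_parabolicCylinder_bounds_of_fullMorreyTypeINear {ν T : ℝ} (hν : 0 < ν) (hT : 0 < T)
    {u : ℝ → EuclideanSpace ℝ (Fin 3) → EuclideanSpace ℝ (Fin 3)} {p : ℝ → EuclideanSpace ℝ (Fin 3) → ℝ}
    (hcl : IsClassicalNSSolutionOn (Ico 0 T) ν 0 u p) (hLH : IsLerayHopfOn T ν 0 (u 0) u)
    (hdec : HasRapidSpatialDecay (u 0)) (hFM : FullMorreyTypeINear u T) :
    ∃ K : ℝ, 0 ≤ K ∧ ∃ r₁ : ℝ, 0 < r₁ ∧ ∃ T₁' < T, ∀ t : ℝ, t ≤ T → ∀ r : ℝ, 0 < r → r < r₁ → T₁' < t - r ^ 2 →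
      ∀ x : EuclideanSpace ℝ (Fin 3),
        (∫⁻ z in Ioo (t - r ^ 2) t ×ˢ ball x r, ENNReal.ofReal (frobeniusNormSq (fderiv ℝ (u z.1) z.2))) ≤
            ENNReal.ofReal (K * r) ∧
        (∫⁻ z in Ioo (t - r ^ 2) t ×ˢ ball x r, ‖u z.1 z.2‖ₑ ^ (3 : ℕ)) ≤ ENNReal.ofReal (K * r ^ 2) := by
  obtain ⟨M, hM, r₁, hr₁, T₁, hT₁, hMor⟩ := hFM
  obtain ⟨K, hK, h⟩ := exists_parabolicCylinder_bounds_of_fullMorrey hν hT hcl hLH hdec hM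
    (fun s hs y ρ hρ hρr => hMor s hs y ρ hρ hρr)
  exact ⟨K, hK, r₁, hr₁, max T₁ 0, max_lt hT₁ hT, fun t htT r hr hrr₁ hbase x => h t htT r hr hrr₁ hbase x⟩

end Summit.NavierStokesRegularity.NavierStokesRegularity.Theorems.L3TimeExponentPincerFullMorreyTypeICylinders

end
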